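import Literature.NumberTheory.Sieve.VaughanMeanValueDecomposition
import Literature.NumberTheory.DiophantineGeometry.SquarefulSumsCountingTools
import HarnessLib

/-!
# Conrey–Iwaniec (2002), Theorem 6.1: smoothly weighted divisor moments (6.16)–(6.17), (6.30)

B. Conrey, H. Iwaniec, Acta Arith. 103 (2002), §6 (6.16)–(6.17), (6.29)–(6.30) [held text
`paper:arxiv-math_0111012`, p0015]. For the sequence `a_n = λ(n)a(n)` with `|a_n| ≤ τ(n)(1+n/Y)⁻⁴`
(6.16) one has `G₁ = Σ n|a_n|² ≪ Y²log³Y`, `G₂ = Σ n²|a_n|² ≪ Y³log³Y` (6.17) and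
`Σ|a_n| ≪ Y log Y`; these follow from the mean values `Σ_{n≤x}τ(n)² ≤ x(1+log x)³` (tree
`Sieve.Vaughan.sum_sq_card_divisors_le`) and `Σ_{n≤x}τ(n) ≤ x(1+log x)` (tree
`SquarefulCount.sum_card_divisors_le`) by a dyadic layer-cake decomposition of the weight
`(1+n/Y)^{-m}` (no partial summation). Also: the tail `Σ_{h>H}(1+log h)/h² ≤ (2+log H)/H` used for
the truncation of `D(v) = Σ_h σ(h)L(hv)` at `h ≤ H` (6.29)–(6.30).

PROVED HERE (namespace `ConreyIwaniec2002.Thm61DivisorMoments`): `weight_le_layerCake`,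
`sum_weighted_le` (finite layer cake), `weighted_moment_le` (general `Σ n^k(1+n/Y)^{-m}f(n)`),
`divisorSq_moment_le` (`k = 0,1,2`, `m = 8`), `divisor_moment_le` (`m = 4`),
`sum_Ioc_log_div_sq_le`, `tsum_log_div_sq_shift_le`, `tsum_log_div_sq_le_three`.
Helpers for stub S2c `stub_thm61_assembly` of SKELETON P64 (line `thm61-cm-convolution`).

## References
* [ConreyIwaniec2002] B. Conrey, H. Iwaniec, Acta Arith. 103 (2002) 259–312: §6 (6.16)–(6.17), (6.29)–(6.30).
-/

noncomputable section

open Real Finset MeasureTheory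

namespace Literature.NumberTheory.LFunctions

namespace ConreyIwaniec2002

namespace Thm61DivisorMoments

/-! ### The dyadic layer cake for `(1 + n/Y)^{-m}` -/

/-- For `x ≤ 2^{J+1}Y`: `(1+n/Y)^{-m} ≤ Σ_{j≤J} 2^{-mj}·𝟙[n ≤ 2^{j+1}Y]`.
[cite: ConreyIwaniec2002, §6 (6.17)] -/
theorem weight_le_layerCake {Y : ℝ} (hY : 0 < Y) (m : ℕ) {x : ℝ} (hx : 0 ≤ x) {J : ℕ}
    (hJ : x ≤ 2 ^ (J + 1) * Y) :
    ((1 + x / Y) ^ m)⁻¹ ≤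
      ∑ j ∈ range (J + 1), ((2:ℝ) ^ (m * j))⁻¹ * (if x ≤ 2 ^ (j + 1) * Y then 1 else 0) := by
  classical
  have hex : ∃ j, x ≤ 2 ^ (j + 1) * Y := ⟨J, hJ⟩
  have hi_spec : x ≤ 2 ^ (Nat.find hex + 1) * Y := Nat.find_spec hex
  have hi_le : Nat.find hex ≤ J := Nat.find_min' hex hJ
  have hmem : Nat.find hex ∈ range (J + 1) := mem_range.mpr (by omega)
  have hxY : 0 ≤ x / Y := by positivity
  have hbase : 1 ≤ 1 + x / Y := by linarith
  -- the weight is at most `2^{-mi}`, `i = Nat.find hex`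
  have hw : ((1 + x / Y) ^ m)⁻¹ ≤ ((2:ℝ) ^ (m * Nat.find hex))⁻¹ := by
    rcases Nat.eq_zero_or_pos (Nat.find hex) with h0 | hpos
    · rw [h0, mul_zero, pow_zero, inv_one]
      exact inv_le_one_of_one_le₀ (one_le_pow₀ hbase)
    · obtain ⟨i', hi'⟩ : ∃ i', Nat.find hex = i' + 1 := ⟨Nat.find hex - 1, by omega⟩
      have hnot : ¬ x ≤ 2 ^ (i' + 1) * Y := Nat.find_min hex (by omega)
      push Not at hnot
      have h1 : (2:ℝ) ^ (i' + 1) ≤ 1 + x / Y := by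
        have : (2:ℝ) ^ (i' + 1) ≤ x / Y := by
          rw [le_div_iff₀ hY]; exact hnot.le
        linarith
      rw [hi']
      refine inv_anti₀ (by positivity) ?_
      calc (2:ℝ) ^ (m * (i' + 1)) = ((2:ℝ) ^ (i' + 1)) ^ m := by rw [mul_comm, pow_mul]
        _ ≤ (1 + x / Y) ^ m := pow_le_pow_left₀ (by positivity) h1 m
  calc ((1 + x / Y) ^ m)⁻¹ ≤ ((2:ℝ) ^ (m * Nat.find hex))⁻¹ := hw
    _ = ((2:ℝ) ^ (m * Nat.find hex))⁻¹ * (if x ≤ 2 ^ (Nat.find hex + 1) * Y then 1 else 0) := by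
        rw [if_pos hi_spec, mul_one]
    _ ≤ ∑ j ∈ range (J + 1), ((2:ℝ) ^ (m * j))⁻¹ * (if x ≤ 2 ^ (j + 1) * Y then 1 else 0) := by
        refine single_le_sum (f := fun j => ((2:ℝ) ^ (m * j))⁻¹ *
          (if x ≤ 2 ^ (j + 1) * Y then (1:ℝ) else 0)) (fun j _ => ?_) hmem
        positivity

/-- `(j+2)³ ≤ 8·4^j`. [folklore] -/
private theorem cube_le_geom (j : ℕ) : ((j : ℝ) + 2) ^ 3 ≤ 8 * 4 ^ j := by
  induction j with
  | zero => norm_num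
  | succ i ih =>
    have h1 : ((i : ℝ) + 1 + 2) ^ 3 ≤ 4 * ((i : ℝ) + 2) ^ 3 := by
      nlinarith [sq_nonneg ((i : ℝ) + 2), sq_nonneg (i : ℝ), (Nat.cast_nonneg i : (0:ℝ) ≤ i)]
    calc (((i + 1 : ℕ) : ℝ) + 2) ^ 3 = ((i : ℝ) + 1 + 2) ^ 3 := by push_cast; ring
      _ ≤ 4 * ((i : ℝ) + 2) ^ 3 := h1
      _ ≤ 4 * (8 * 4 ^ i) := by gcongr
      _ = 8 * 4 ^ (i + 1) := by ring

/-- The `j`-th layer coefficient: `2^{-mj}·2^{(j+1)(k+1)}·(j+2)^p ≤ 2^{k+4}·2^{-j}` for `k + 4 ≤ m`,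
`p ≤ 3`. [folklore] -/
private theorem layer_coeff_le {k m p : ℕ} (hkm : k + 4 ≤ m) (hp : p ≤ 3) (j : ℕ) :
    ((2:ℝ) ^ (m * j))⁻¹ * ((2:ℝ) ^ ((j + 1) * (k + 1)) * ((j : ℝ) + 2) ^ p) ≤
      (2:ℝ) ^ (k + 4) * ((1 / 2 : ℝ)) ^ j := by
  have hj2 : (1:ℝ) ≤ (j : ℝ) + 2 := by have := (Nat.cast_nonneg j : (0:ℝ) ≤ j); linarith
  have hp3 : ((j : ℝ) + 2) ^ p ≤ ((j : ℝ) + 2) ^ 3 := pow_le_pow_right₀ hj2 hp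
  have hc := cube_le_geom j
  -- reduce to a comparison of powers of two
  obtain ⟨r, hr⟩ : ∃ r, m = k + 4 + r := ⟨m - (k + 4), by omega⟩
  rw [hr]
  have h2 : (0:ℝ) < 2 := by norm_num
  have key : ((2:ℝ) ^ ((k + 4 + r) * j))⁻¹ * ((2:ℝ) ^ ((j + 1) * (k + 1)) * (8 * 4 ^ j)) ≤
      (2:ℝ) ^ (k + 4) * ((1 / 2 : ℝ)) ^ j := by
    have e1 : (8 : ℝ) * 4 ^ j = 2 ^ (3 + 2 * j) := by
      rw [pow_add, pow_mul]; norm_num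
    have e2 : ((1 / 2 : ℝ)) ^ j = ((2:ℝ) ^ j)⁻¹ := by rw [one_div, inv_pow]
    rw [e1, e2, ← pow_add]
    rw [inv_mul_le_iff₀ (by positivity), ← mul_assoc, le_mul_inv_iff₀ (by positivity), ← pow_add,
      ← pow_add]
    refine pow_le_pow_right₀ (by norm_num) ?_
    nlinarith
  calc ((2:ℝ) ^ ((k + 4 + r) * j))⁻¹ * ((2:ℝ) ^ ((j + 1) * (k + 1)) * ((j : ℝ) + 2) ^ p)
      ≤ ((2:ℝ) ^ ((k + 4 + r) * j))⁻¹ * ((2:ℝ) ^ ((j + 1) * (k + 1)) * (8 * 4 ^ j)) := by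
        gcongr; exact hp3.trans hc
    _ ≤ _ := key

/-- `Σ_{j<n} (1/2)^j ≤ 2`. [folklore] -/
private theorem geom_half_le (n : ℕ) : ∑ j ∈ range n, ((1 / 2 : ℝ)) ^ j ≤ 2 := by
  have h := geom_sum_Ico_le_of_lt_one (m := 0) (n := n) (x := (1 / 2 : ℝ)) (by norm_num) (by norm_num)
  rw [← range_eq_Ico] at h
  refine h.trans ?_
  norm_num

/-- **Finite layer-cake bound.** If `f ≥ 0` and `Σ_{n≤N} f(n) ≤ A·N·(1+log N)^p` for all `N`
(`p ≤ 3`), then for `Y ≥ 2`, `k + 4 ≤ m` and `M ≤ 2^{J+1}Y`: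
`Σ_{1≤n≤M} n^k(1+n/Y)^{-m}f(n) ≤ 2^{k+5}·A·Y^{k+1}(1+log Y)^p`. [cite: ConreyIwaniec2002, §6 (6.17)] -/
theorem sum_weighted_le {f : ℕ → ℝ} (hf : ∀ n, 0 ≤ f n) {A : ℝ} (hA : 0 ≤ A) {p : ℕ} (hp : p ≤ 3)
    (hF : ∀ N : ℕ, ∑ n ∈ Icc 1 N, f n ≤ A * N * (1 + Real.log N) ^ p)
    {k m : ℕ} (hkm : k + 4 ≤ m) {Y : ℝ} (hY : 2 ≤ Y) {M J : ℕ} (hMJ : (M : ℝ) ≤ 2 ^ (J + 1) * Y) :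
    ∑ n ∈ Icc 1 M, (n : ℝ) ^ k * ((1 + (n : ℝ) / Y) ^ m)⁻¹ * f n ≤
      2 ^ (k + 5) * A * Y ^ (k + 1) * (1 + Real.log Y) ^ p := by
  have hY0 : 0 < Y := by linarith
  have hlogY : 0 ≤ Real.log Y := Real.log_nonneg (by linarith)
  set L := 1 + Real.log Y with hL
  have hL1 : 1 ≤ L := by rw [hL]; linarith
  -- Step 1: insert the layer cake and swap the sums
  have h1 : ∀ n ∈ Icc 1 M, (n : ℝ) ^ k * ((1 + (n : ℝ) / Y) ^ m)⁻¹ * f n ≤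
      ∑ j ∈ range (J + 1), ((2:ℝ) ^ (m * j))⁻¹ *
        ((if (n : ℝ) ≤ 2 ^ (j + 1) * Y then (1:ℝ) else 0) * ((n : ℝ) ^ k * f n)) := by
    intro n hn
    have hnM : (n : ℝ) ≤ 2 ^ (J + 1) * Y := le_trans (by exact_mod_cast (mem_Icc.mp hn).2) hMJ
    have hw := weight_le_layerCake hY0 m (Nat.cast_nonneg n) hnM
    have hnn : 0 ≤ (n : ℝ) ^ k * f n := mul_nonneg (by positivity) (hf n)
    calc (n : ℝ) ^ k * ((1 + (n : ℝ) / Y) ^ m)⁻¹ * f n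
        = ((1 + (n : ℝ) / Y) ^ m)⁻¹ * ((n : ℝ) ^ k * f n) := by ring
      _ ≤ (∑ j ∈ range (J + 1), ((2:ℝ) ^ (m * j))⁻¹ *
            (if (n : ℝ) ≤ 2 ^ (j + 1) * Y then (1:ℝ) else 0)) * ((n : ℝ) ^ k * f n) :=
          mul_le_mul_of_nonneg_right hw hnn
      _ = _ := by rw [sum_mul]; refine sum_congr rfl fun j _ => ?_; ring
  refine (sum_le_sum h1).trans ?_
  rw [sum_comm]
  -- Step 2: each layer
  have h2 : ∀ j ∈ range (J + 1), ∑ n ∈ Icc 1 M, ((2:ℝ) ^ (m * j))⁻¹ *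
      ((if (n : ℝ) ≤ 2 ^ (j + 1) * Y then (1:ℝ) else 0) * ((n : ℝ) ^ k * f n)) ≤
      ((2:ℝ) ^ (m * j))⁻¹ * ((2:ℝ) ^ ((j + 1) * (k + 1)) * ((j : ℝ) + 2) ^ p) *
        (A * Y ^ (k + 1) * L ^ p) := by
    intro j _
    rw [← mul_sum, mul_assoc]
    refine mul_le_mul_of_nonneg_left ?_ (by positivity)
    set N : ℕ := ⌊(2:ℝ) ^ (j + 1) * Y⌋₊ with hN
    have hXpos : (0:ℝ) < 2 ^ (j + 1) * Y := by positivity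
    have hNle : (N : ℝ) ≤ 2 ^ (j + 1) * Y := Nat.floor_le hXpos.le
    -- restrict to `n ≤ N`, drop the indicator
    have h21 : ∑ n ∈ Icc 1 M, (if (n : ℝ) ≤ 2 ^ (j + 1) * Y then (1:ℝ) else 0) * ((n : ℝ) ^ k * f n) ≤
        ∑ n ∈ Icc 1 N, (n : ℝ) ^ k * f n := by
      simp_rw [boole_mul]
      rw [← sum_filter]
      refine sum_le_sum_of_subset_of_nonneg (fun n hn => ?_) fun n _ _ => mul_nonneg (by positivity) (hf n)
      rw [mem_filter, mem_Icc] at hn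
      rw [mem_Icc]
      exact ⟨hn.1.1, Nat.le_floor hn.2⟩
    -- `n^k ≤ (2^{j+1}Y)^k` on the range
    have h22 : ∑ n ∈ Icc 1 N, (n : ℝ) ^ k * f n ≤ (2 ^ (j + 1) * Y) ^ k * ∑ n ∈ Icc 1 N, f n := by
      rw [mul_sum]
      refine sum_le_sum fun n hn => mul_le_mul_of_nonneg_right ?_ (hf n)
      exact pow_le_pow_left₀ (Nat.cast_nonneg n)
        ((Nat.cast_le.mpr (mem_Icc.mp hn).2).trans hNle) k
    -- the mean value and the logarithm
    have h23 : ∑ n ∈ Icc 1 N, f n ≤ A * (2 ^ (j + 1) * Y) * (((j : ℝ) + 2) * L) ^ p := by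
      refine (hF N).trans ?_
      have hlogN : 1 + Real.log N ≤ ((j : ℝ) + 2) * L := by
        have hj0 : (0:ℝ) ≤ j := Nat.cast_nonneg j
        rcases Nat.eq_zero_or_pos N with h0 | hpos
        · rw [h0, Nat.cast_zero, Real.log_zero, add_zero]
          nlinarith
        · have : Real.log N ≤ (j + 1) * Real.log 2 + Real.log Y := by
            calc Real.log N ≤ Real.log (2 ^ (j + 1) * Y) :=
                  Real.log_le_log (by exact_mod_cast hpos) hNle
              _ = (j + 1) * Real.log 2 + Real.log Y := by
                  rw [Real.log_mul (by positivity) hY0.ne', Real.log_pow]; push_cast; ring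
          have hl2 : Real.log 2 ≤ 1 := by
            have := Real.log_two_lt_d9; linarith
          rw [hL]
          nlinarith
      have hlogN0 : 0 ≤ 1 + Real.log N := by
        have : 0 ≤ Real.log (N : ℝ) := Real.log_natCast_nonneg N
        linarith
      gcongr
    calc ∑ n ∈ Icc 1 M, (if (n : ℝ) ≤ 2 ^ (j + 1) * Y then (1:ℝ) else 0) * ((n : ℝ) ^ k * f n)
        ≤ (2 ^ (j + 1) * Y) ^ k * (A * (2 ^ (j + 1) * Y) * (((j : ℝ) + 2) * L) ^ p) :=
          h21.trans (h22.trans (mul_le_mul_of_nonneg_left h23 (by positivity)))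
      _ = (2:ℝ) ^ ((j + 1) * (k + 1)) * ((j : ℝ) + 2) ^ p * (A * Y ^ (k + 1) * L ^ p) := by
          rw [mul_pow, mul_pow, pow_mul]; ring
  refine (sum_le_sum h2).trans ?_
  rw [← sum_mul]
  -- Step 3: the geometric sum of the layer coefficients
  have h3 : ∑ j ∈ range (J + 1), ((2:ℝ) ^ (m * j))⁻¹ * ((2:ℝ) ^ ((j + 1) * (k + 1)) * ((j : ℝ) + 2) ^ p)
      ≤ (2:ℝ) ^ (k + 5) := by
    calc ∑ j ∈ range (J + 1), ((2:ℝ) ^ (m * j))⁻¹ * ((2:ℝ) ^ ((j + 1) * (k + 1)) * ((j : ℝ) + 2) ^ p)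
        ≤ ∑ j ∈ range (J + 1), (2:ℝ) ^ (k + 4) * ((1 / 2 : ℝ)) ^ j :=
          sum_le_sum fun j _ => layer_coeff_le hkm hp j
      _ = (2:ℝ) ^ (k + 4) * ∑ j ∈ range (J + 1), ((1 / 2 : ℝ)) ^ j := by rw [mul_sum]
      _ ≤ (2:ℝ) ^ (k + 4) * 2 := by gcongr; exact geom_half_le _
      _ = (2:ℝ) ^ (k + 5) := by ring
  calc (∑ j ∈ range (J + 1), ((2:ℝ) ^ (m * j))⁻¹ * ((2:ℝ) ^ ((j + 1) * (k + 1)) * ((j : ℝ) + 2) ^ p)) *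
        (A * Y ^ (k + 1) * L ^ p) ≤ (2:ℝ) ^ (k + 5) * (A * Y ^ (k + 1) * L ^ p) :=
        mul_le_mul_of_nonneg_right h3 (by positivity)
    _ = 2 ^ (k + 5) * A * Y ^ (k + 1) * L ^ p := by ring

/-- Tail estimate: for `n > Y³` (`Y ≥ 2`), `f(n) ≤ n^d`, `3(k+d) + 4 ≤ 2m`:
`n^k(1+n/Y)^{-m}f(n) ≤ n^{-4/3}`. [folklore] -/
private theorem term_tail_le {f : ℕ → ℝ} (hf : ∀ n, 0 ≤ f n) {d : ℕ} (hfd : ∀ n, f n ≤ (n : ℝ) ^ d)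
    {k m : ℕ} (htail : 3 * (k + d) + 4 ≤ 2 * m) {Y : ℝ} (hY : 2 ≤ Y) {n : ℕ} (hn : Y ^ 3 < n) :
    (n : ℝ) ^ k * ((1 + (n : ℝ) / Y) ^ m)⁻¹ * f n ≤ ((n : ℝ) ^ (4 / 3 : ℝ))⁻¹ := by
  have hY0 : 0 < Y := by linarith
  have hn1 : (1 : ℝ) < n := lt_of_le_of_lt (one_le_pow₀ (by linarith : (1:ℝ) ≤ Y)) hn
  have hn0 : (0 : ℝ) < n := by linarith
  -- `(1+n/Y)^{-m} ≤ (Y/n)^m = Y^m / n^m`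
  have hw : ((1 + (n : ℝ) / Y) ^ m)⁻¹ ≤ Y ^ m / (n : ℝ) ^ m := by
    rw [← div_pow, ← inv_pow, ← one_div]
    refine pow_le_pow_left₀ (by positivity) ?_ m
    rw [div_le_div_iff₀ (by positivity) hn0, one_mul]
    have : (n : ℝ) / Y * Y = n := div_mul_cancel₀ _ hY0.ne'
    nlinarith
  -- `Y < n^{1/3}` hence `Y^m ≤ n^{m/3}`
  have hY3 : Y ≤ (n : ℝ) ^ ((1:ℝ) / 3) := by
    have h : (Y ^ 3) ^ ((1:ℝ) / 3) ≤ ((n : ℝ)) ^ ((1:ℝ) / 3) :=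
      Real.rpow_le_rpow (by positivity) hn.le (by norm_num)
    rwa [show (Y ^ 3) ^ ((1:ℝ) / 3) = Y by
      rw [← Real.rpow_natCast, ← Real.rpow_mul hY0.le]; norm_num] at h
  have hYm : Y ^ m ≤ (n : ℝ) ^ ((m : ℝ) / 3) := by
    calc Y ^ m ≤ ((n : ℝ) ^ ((1:ℝ) / 3)) ^ m := pow_le_pow_left₀ hY0.le hY3 m
      _ = (n : ℝ) ^ ((m : ℝ) / 3) := by
          rw [← Real.rpow_natCast, ← Real.rpow_mul hn0.le]; ring_nf
  -- assemble in `rpow`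
  have hk : ((n : ℝ)) ^ k = (n : ℝ) ^ (k : ℝ) := (Real.rpow_natCast _ _).symm
  have hm' : ((n : ℝ)) ^ m = (n : ℝ) ^ (m : ℝ) := (Real.rpow_natCast _ _).symm
  have hd' : ((n : ℝ)) ^ d = (n : ℝ) ^ (d : ℝ) := (Real.rpow_natCast _ _).symm
  calc (n : ℝ) ^ k * ((1 + (n : ℝ) / Y) ^ m)⁻¹ * f n
      ≤ (n : ℝ) ^ k * (Y ^ m / (n : ℝ) ^ m) * (n : ℝ) ^ d :=
        mul_le_mul (mul_le_mul_of_nonneg_left hw (by positivity)) (hfd n) (hf n) (by positivity)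
    _ ≤ (n : ℝ) ^ k * ((n : ℝ) ^ ((m : ℝ) / 3) / (n : ℝ) ^ m) * (n : ℝ) ^ d := by gcongr
    _ = (n : ℝ) ^ ((k : ℝ) + (m : ℝ) / 3 - m + d) := by
        rw [hk, hm', hd', Real.rpow_add hn0, Real.rpow_sub hn0, Real.rpow_add hn0]; ring
    _ ≤ (n : ℝ) ^ (-(4 / 3 : ℝ)) := by
        refine Real.rpow_le_rpow_of_exponent_le hn1.le ?_
        have h := (Nat.cast_le (α := ℝ)).mpr htail
        push_cast at h
        linarith
    _ = ((n : ℝ) ^ (4 / 3 : ℝ))⁻¹ := Real.rpow_neg hn0.le _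

/-- **Weighted moments from mean values.** `f ≥ 0`, `f(0) = 0`, `f(n) ≤ n^d`,
`Σ_{n≤N} f(n) ≤ A·N·(1+log N)^p` (`p ≤ 3`); `k + 4 ≤ m`, `3(k+d) + 4 ≤ 2m`. Then for `Y ≥ 2` the
series `Σ_n n^k(1+n/Y)^{-m}f(n)` converges and is `≤ (2^{k+5}A + ζ(4/3))·Y^{k+1}(1+log Y)^p`.
[cite: ConreyIwaniec2002, §6 (6.17)] -/
theorem weighted_moment_le {f : ℕ → ℝ} (hf : ∀ n, 0 ≤ f n) (hf0 : f 0 = 0) {d : ℕ}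
    (hfd : ∀ n, f n ≤ (n : ℝ) ^ d) {A : ℝ} (hA : 0 ≤ A) {p : ℕ} (hp : p ≤ 3)
    (hF : ∀ N : ℕ, ∑ n ∈ Icc 1 N, f n ≤ A * N * (1 + Real.log N) ^ p)
    {k m : ℕ} (hkm : k + 4 ≤ m) (htail : 3 * (k + d) + 4 ≤ 2 * m) {Y : ℝ} (hY : 2 ≤ Y) :
    Summable (fun n : ℕ => (n : ℝ) ^ k * ((1 + (n : ℝ) / Y) ^ m)⁻¹ * f n) ∧
      ∑' n : ℕ, (n : ℝ) ^ k * ((1 + (n : ℝ) / Y) ^ m)⁻¹ * f n ≤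
        (2 ^ (k + 5) * A + ∑' n : ℕ, ((n : ℝ) ^ (4 / 3 : ℝ))⁻¹) * Y ^ (k + 1) * (1 + Real.log Y) ^ p := by
  have hY0 : 0 < Y := by linarith
  have hY1 : 1 ≤ Y := by linarith
  set M : ℕ := ⌊Y ^ 3⌋₊ with hM
  set F : ℕ → ℝ := fun n => (n : ℝ) ^ k * ((1 + (n : ℝ) / Y) ^ m)⁻¹ * f n with hFdef
  set g : ℕ → ℝ := fun n => if n ≤ M then F n else 0 with hg
  set t : ℕ → ℝ := fun n => ((n : ℝ) ^ (4 / 3 : ℝ))⁻¹ with ht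
  have hF0 : ∀ n, 0 ≤ F n := fun n => mul_nonneg (by positivity) (hf n)
  have ht0 : ∀ n, 0 ≤ t n := fun n => by positivity
  have hFle : ∀ n, F n ≤ g n + t n := by
    intro n
    by_cases hn : n ≤ M
    · simp only [hg, if_pos hn]; linarith [ht0 n]
    · simp only [hg, if_neg hn, zero_add]
      have hn' : Y ^ 3 < n := by
        have := Nat.lt_of_floor_lt (not_le.mp hn)
        exact_mod_cast this
      exact term_tail_le hf hfd htail hY hn'
  have hgs : Summable g := summable_of_ne_finset_zero (s := range (M + 1)) fun n hn => by
    simp only [mem_range, not_lt] at hn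
    simp [hg, show ¬ n ≤ M by omega]
  have hts : Summable t := Real.summable_nat_rpow_inv.mpr (by norm_num)
  have hFs : Summable F := Summable.of_nonneg_of_le hF0 hFle (hgs.add hts)
  refine ⟨hFs, ?_⟩
  -- the finite part
  have hJ : (M : ℝ) ≤ 2 ^ (M + 1) * Y := by
    have h1 : (M : ℝ) < 2 ^ (M + 1) := by
      have := Nat.lt_two_pow_self (n := M)
      exact_mod_cast this.trans_le (Nat.pow_le_pow_right (by norm_num) (Nat.le_succ M))
    nlinarith [pow_pos (two_pos : (0:ℝ) < 2) (M + 1)]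
  have hfin : ∑' n, g n ≤ 2 ^ (k + 5) * A * Y ^ (k + 1) * (1 + Real.log Y) ^ p := by
    rw [tsum_eq_sum (s := Icc 1 M) (fun n hn => by
      rw [mem_Icc, not_and_or, not_le, not_le] at hn
      rcases hn with h | h
      · have : n = 0 := by omega
        simp [hg, hFdef, this, hf0]
      · simp [hg, show ¬ n ≤ M by omega])]
    have : ∑ n ∈ Icc 1 M, g n = ∑ n ∈ Icc 1 M, F n :=
      sum_congr rfl fun n hn => by simp [hg, (mem_Icc.mp hn).2]
    rw [this]
    exact sum_weighted_le hf hA hp hF hkm hY hJ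
  have hpos : 1 ≤ Y ^ (k + 1) * (1 + Real.log Y) ^ p := by
    have h1 : 1 ≤ Y ^ (k + 1) := one_le_pow₀ hY1
    have h2 : 1 ≤ (1 + Real.log Y) ^ p := one_le_pow₀ (by
      have := Real.log_nonneg hY1; linarith)
    nlinarith
  have hZ : 0 ≤ ∑' n, t n := tsum_nonneg ht0
  calc ∑' n, F n ≤ ∑' n, (g n + t n) := hFs.tsum_le_tsum hFle (hgs.add hts)
    _ = ∑' n, g n + ∑' n, t n := hgs.tsum_add hts
    _ ≤ 2 ^ (k + 5) * A * Y ^ (k + 1) * (1 + Real.log Y) ^ p +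
          (∑' n, t n) * (Y ^ (k + 1) * (1 + Real.log Y) ^ p) := by
        gcongr
        exact le_mul_of_one_le_right hZ hpos
    _ = (2 ^ (k + 5) * A + ∑' n : ℕ, ((n : ℝ) ^ (4 / 3 : ℝ))⁻¹) * Y ^ (k + 1) *
          (1 + Real.log Y) ^ p := by rw [ht]; ring

/-! ### The instances: `τ(n)²` with weight `(1+n/Y)^{-8}`, `τ(n)` with weight `(1+n/Y)^{-4}` -/

/-- `Icc 1 N = Ioc 0 N` in `ℕ`. [folklore] -/
private theorem Icc_one_eq_Ioc (N : ℕ) : Icc 1 N = Ioc 0 N := by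
  ext n; simp only [mem_Icc, mem_Ioc]; omega

/-- **(6.17): `Σ_n n^k(1+n/Y)^{-8}τ(n)² ≤ C·Y^{k+1}(1+log Y)³` for `k ≤ 2`, `Y ≥ 2`** (so
`G₁ ≪ Y²log³Y`, `G₂ ≪ Y³log³Y` for `|a_n| ≤ τ(n)(1+n/Y)⁻⁴`). [cite: ConreyIwaniec2002, §6 (6.17)] -/
theorem divisorSq_moment_le {k : ℕ} (hk : k ≤ 2) :
    ∃ C : ℝ, 0 < C ∧ ∀ Y : ℝ, 2 ≤ Y →
      Summable (fun n : ℕ => (n : ℝ) ^ k * ((1 + (n : ℝ) / Y) ^ 8)⁻¹ * (n.divisors.card : ℝ) ^ 2) ∧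
      ∑' n : ℕ, (n : ℝ) ^ k * ((1 + (n : ℝ) / Y) ^ 8)⁻¹ * (n.divisors.card : ℝ) ^ 2 ≤
        C * Y ^ (k + 1) * (1 + Real.log Y) ^ 3 := by
  refine ⟨2 ^ (k + 5) * 1 + ∑' n : ℕ, ((n : ℝ) ^ (4 / 3 : ℝ))⁻¹, by positivity, fun Y hY => ?_⟩
  have hF : ∀ N : ℕ, ∑ n ∈ Icc 1 N, (n.divisors.card : ℝ) ^ 2 ≤ 1 * N * (1 + Real.log N) ^ 3 := by
    intro N
    rw [one_mul, Icc_one_eq_Ioc]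
    have h := Literature.NumberTheory.Sieve.Vaughan.sum_sq_card_divisors_le N
    exact_mod_cast h
  exact weighted_moment_le (f := fun n => (n.divisors.card : ℝ) ^ 2) (fun n => by positivity)
    (by simp) (d := 2) (fun n => by exact_mod_cast Nat.pow_le_pow_left (Nat.card_divisors_le_self n) 2)
    zero_le_one le_rfl hF (by omega) (by omega) hY

/-- **`Σ_n (1+n/Y)^{-4}τ(n) ≤ C·Y(1+log Y)` for `Y ≥ 2`** (so `Σ|a_n| ≪ Y log Y` for
`|a_n| ≤ τ(n)(1+n/Y)⁻⁴`). [cite: ConreyIwaniec2002, §6 (6.17)] -/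
theorem divisor_moment_le :
    ∃ C : ℝ, 0 < C ∧ ∀ Y : ℝ, 2 ≤ Y →
      Summable (fun n : ℕ => ((1 + (n : ℝ) / Y) ^ 4)⁻¹ * (n.divisors.card : ℝ)) ∧
      ∑' n : ℕ, ((1 + (n : ℝ) / Y) ^ 4)⁻¹ * (n.divisors.card : ℝ) ≤ C * Y * (1 + Real.log Y) := by
  refine ⟨2 ^ (0 + 5) * 1 + ∑' n : ℕ, ((n : ℝ) ^ (4 / 3 : ℝ))⁻¹, by positivity, fun Y hY => ?_⟩
  have hF : ∀ N : ℕ, ∑ n ∈ Icc 1 N, (n.divisors.card : ℝ) ≤ 1 * N * (1 + Real.log N) ^ 1 := by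
    intro N
    rw [one_mul, pow_one]
    exact Literature.NumberTheory.DiophantineGeometry.SquarefulCount.sum_card_divisors_le N
  have h := weighted_moment_le (f := fun n => (n.divisors.card : ℝ)) (fun n => by positivity)
    (by simp) (d := 1) (fun n => by rw [pow_one]; exact_mod_cast Nat.card_divisors_le_self n)
    zero_le_one (by norm_num : 1 ≤ 3) hF (k := 0) (m := 4) (by omega) (by omega) hY
  simp only [pow_zero, one_mul, zero_add, pow_one] at h
  exact h

/-! ### The logarithmic tail `Σ_{h>H}(1+log h)/h² ≤ (2+log H)/H` -/

/-- `Σ_{H<h≤N}(1+log h)/h² ≤ (2+log H)/H` for `H ≥ 1` (comparison with `∫_H^∞(1+log x)x⁻²dx`).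
[cite: ConreyIwaniec2002, §6 (6.29)–(6.30)] -/
theorem sum_Ioc_log_div_sq_le {H : ℕ} (hH : 1 ≤ H) (N : ℕ) :
    ∑ h ∈ Ioc H N, (1 + Real.log h) / (h : ℝ) ^ 2 ≤ (2 + Real.log H) / H := by
  have hH0 : (0:ℝ) < H := by exact_mod_cast hH
  have hRHS : 0 ≤ (2 + Real.log H) / H := by
    have := Real.log_natCast_nonneg H; positivity
  rcases le_or_gt N H with hNH | hHN
  · rw [Finset.Ioc_eq_empty (by omega), sum_empty]; exact hRHS
  set f : ℝ → ℝ := fun x => (1 + Real.log x) / x ^ 2 with hf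
  set F : ℝ → ℝ := fun x => -(2 + Real.log x) / x with hF
  -- derivative facts on `x > 0`
  have hderivF : ∀ x : ℝ, 0 < x → HasDerivAt F (f x) x := by
    intro x hx
    have h1 : HasDerivAt (fun x => -(2 + Real.log x)) (-(x⁻¹)) x :=
      ((Real.hasDerivAt_log hx.ne').const_add 2).neg
    have h2 := h1.div (hasDerivAt_id x) hx.ne'
    refine h2.congr_deriv ?_
    simp only [hf, id]
    field_simp
    ring
  have hderivf : ∀ x : ℝ, 0 < x → HasDerivAt f (-(1 + 2 * Real.log x) / x ^ 3) x := by
    intro x hx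
    have h1 : HasDerivAt (fun x => 1 + Real.log x) (x⁻¹) x := by
      simpa using (Real.hasDerivAt_log hx.ne').const_add 1
    have h2 := h1.div (hasDerivAt_pow 2 x) (pow_ne_zero 2 hx.ne')
    refine h2.congr_deriv ?_
    push_cast
    field_simp
    ring
  have hcont : ContinuousOn f (Set.Ici (1:ℝ)) := fun x hx =>
    (hderivf x (by linarith [Set.mem_Ici.mp hx])).continuousAt.continuousWithinAt
  have hanti : AntitoneOn f (Set.Icc (H : ℝ) N) := by
    have hA : AntitoneOn f (Set.Ici (1:ℝ)) := by
      refine antitoneOn_of_deriv_nonpos (convex_Ici 1) hcont ?_ ?_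
      · intro x hx
        rw [interior_Ici] at hx
        exact (hderivf x (by linarith [Set.mem_Ioi.mp hx])).differentiableAt.differentiableWithinAt
      · intro x hx
        rw [interior_Ici] at hx
        have hx1 : 1 < x := hx
        rw [(hderivf x (by linarith)).deriv]
        have : 0 ≤ Real.log x := Real.log_nonneg hx1.le
        apply div_nonpos_of_nonpos_of_nonneg
        · linarith
        · positivity
    exact hA.mono fun x hx => Set.mem_Ici.mpr (le_trans (by exact_mod_cast hH) hx.1)
  -- sum ≤ integral
  have hsum := AntitoneOn.sum_le_integral_Ico hHN.le hanti
  have hIoc : Ioc H N = Ico (H + 1) (N + 1) := by ext h; simp only [mem_Ico, mem_Ioc]; omega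
  have hreindex : ∑ i ∈ Ico H N, f ((i + 1 : ℕ) : ℝ) = ∑ h ∈ Ioc H N, (1 + Real.log h) / (h : ℝ) ^ 2 := by
    rw [hIoc, ← Finset.sum_Ico_add' (fun h : ℕ => (1 + Real.log h) / (h : ℝ) ^ 2) H N 1]
  rw [← hreindex]
  refine hsum.trans ?_
  -- evaluate the integral
  have hint : ∫ x in (H : ℝ)..N, f x = F N - F H := by
    refine intervalIntegral.integral_eq_sub_of_hasDerivAt (fun x hx => hderivF x ?_) ?_
    · rw [Set.uIcc_of_le (by exact_mod_cast hHN.le)] at hx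
      linarith [hx.1]
    · refine (hcont.mono fun x hx => ?_).intervalIntegrable
      rw [Set.uIcc_of_le (by exact_mod_cast hHN.le)] at hx
      exact Set.mem_Ici.mpr (le_trans (by exact_mod_cast hH) hx.1)
  rw [hint]
  have hFN : F N ≤ 0 := by
    have hN0 : (0:ℝ) < N := by exact_mod_cast (show 0 < N by omega)
    have := Real.log_natCast_nonneg N
    simp only [hF]
    exact div_nonpos_of_nonpos_of_nonneg (by linarith) hN0.le
  have hFH : F H = -((2 + Real.log H) / H) := by simp only [hF]; ring
  rw [hFH]; linarith

/-- The shifted tail as a series: `Σ_{i≥0}(1+log(i+H+1))/(i+H+1)² ≤ (2+log H)/H` (`H ≥ 1`),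
with summability. [cite: ConreyIwaniec2002, §6 (6.29)–(6.30)] -/
theorem tsum_log_div_sq_shift_le {H : ℕ} (hH : 1 ≤ H) :
    Summable (fun i : ℕ => (1 + Real.log ((i : ℝ) + H + 1)) / ((i : ℝ) + H + 1) ^ 2) ∧
      ∑' i : ℕ, (1 + Real.log ((i : ℝ) + H + 1)) / ((i : ℝ) + H + 1) ^ 2 ≤ (2 + Real.log H) / H := by
  set g : ℕ → ℝ := fun i => (1 + Real.log ((i : ℝ) + H + 1)) / ((i : ℝ) + H + 1) ^ 2 with hg
  have hg0 : ∀ i, 0 ≤ g i := fun i => by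
    have : 0 ≤ Real.log ((i : ℝ) + H + 1) := Real.log_nonneg (by
      have := (Nat.cast_nonneg i : (0:ℝ) ≤ i); have := (Nat.cast_nonneg H : (0:ℝ) ≤ H); linarith)
    positivity
  have hpartial : ∀ n, ∑ i ∈ range n, g i ≤ (2 + Real.log H) / H := by
    intro n
    have h := sum_Ioc_log_div_sq_le hH (H + n)
    have hIoc : Ioc H (H + n) = Ico (H + 1) (H + n + 1) := by
      ext h; simp only [mem_Ico, mem_Ioc]; omega
    have hre : ∑ i ∈ range n, g i = ∑ h ∈ Ioc H (H + n), (1 + Real.log h) / (h : ℝ) ^ 2 := by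
      rw [hIoc, Finset.sum_Ico_eq_sum_range]
      simp only [show H + n + 1 - (H + 1) = n by omega]
      refine sum_congr rfl fun i _ => ?_
      simp only [hg]; push_cast; ring_nf
    rw [hre]; exact h
  have hs : Summable g := summable_of_sum_range_le hg0 hpartial
  exact ⟨hs, hs.tsum_le_of_sum_range_le hpartial⟩

/-- `Σ_{h≥1}(1+log h)/h² ≤ 3` (as the series over `h+1`, `h ≥ 0`), with summability.
[cite: ConreyIwaniec2002, §6 (6.29)] -/
theorem tsum_log_div_sq_le_three :
    Summable (fun h : ℕ => (1 + Real.log ((h : ℝ) + 1)) / ((h : ℝ) + 1) ^ 2) ∧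
      ∑' h : ℕ, (1 + Real.log ((h : ℝ) + 1)) / ((h : ℝ) + 1) ^ 2 ≤ 3 := by
  set g : ℕ → ℝ := fun h => (1 + Real.log ((h : ℝ) + 1)) / ((h : ℝ) + 1) ^ 2 with hg
  obtain ⟨hs1, hle1⟩ := tsum_log_div_sq_shift_le (le_refl 1)
  have hshift : (fun i : ℕ => g (i + 1)) =
      fun i : ℕ => (1 + Real.log ((i : ℝ) + (1 : ℕ) + 1)) / ((i : ℝ) + (1 : ℕ) + 1) ^ 2 := by
    funext i; simp only [hg]; push_cast; ring_nf
  have hs' : Summable (fun i : ℕ => g (i + 1)) := by rw [hshift]; exact hs1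
  have hs : Summable g := (summable_nat_add_iff 1).mp hs'
  refine ⟨hs, ?_⟩
  rw [hs.tsum_eq_zero_add]
  have h0 : g 0 = 1 := by simp [hg]
  rw [h0, hshift]
  simp only [Nat.cast_one, Real.log_one, add_zero, div_one] at hle1
  linarith

end Thm61DivisorMoments

end ConreyIwaniec2002

end Literature.NumberTheory.LFunctions

end
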